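import Summits.SmoothPoincare4.SmoothPoincare4.Theorems.EntropyRungNoncompactShrinkerGapHeatVeryWeakNoncompact
import HarnessLib

/-!
# Lions' very weak existence for the static linear heat equation on a complete manifold from an
# ENERGY INEQUALITY (support item `EntropyRung.BakryEmeryLogSobolev`, stmt-SmoothPoincare4-16587)

This is the shrinker toolkit's `exists_veryWeak_linearHeat_static`
(`EntropyRungNoncompactShrinkerGapHeatVeryWeakNoncompact.lean`, crux `EntropyRung.NoncompactShrinkerGap`,
Trèves 1975, §41: J.-L. Lions' projection lemma in `L²(M × (a, b), V_g ⊗ ds)` with the test space of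
smooth functions vanishing off `K × ℝ`, `K` compact, and for `s ≥ b'`, `b' < b`) with its ONE use of the
pointwise hypothesis `Q ≥ 1` — the energy inequality `‖φ‖² ≤ ⟪𝒜φ, φ⟫`,
`𝒜φ = −∂ₛφ − Δ_g φ(·, s) + Qφ` — turned into a hypothesis `hcoer`. The proof is otherwise that file's,
verbatim (same author line of ideas; adapted here because the weighted manifold of the support item
`BakryEmeryLogSobolev` has an ARBITRARY smooth weight, for which the ground-state potential
`Q_V = ¼|∇V|² − ½ΔV` is unbounded below and coercivity comes instead from the perfect square of
`EntropyRungBakryEmeryLogSobolevSchrodingerCoercivity.lean`).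

**Theorem** (`exists_veryWeak_linearHeat_of_energyIneq`). `(M, g)` Riemannian modelled on `ℝⁿ` (Hausdorff,
second countable, `T₃` — NOT compact), `Q, G` smooth on `M × ℝ` with `G` compactly supported, `a < b`, and
the energy inequality `∫_{M×(a,b)} φ² ≤ ∫_{M×(a,b)} φ 𝒜φ` for every smooth `φ` vanishing off `K × ℝ` (`K`
compact) and for `s ≥ b`. Then there is a measurable `u ∈ L²(V_g ⊗ ds)`, `u = 0` for `s ∉ (a, b)`, with
`∫ u 𝒜ζ d(V_g ⊗ ds) = ∫_{M×(a,b)} G ζ d(V_g ⊗ ds)` for every smooth compactly supported `ζ` with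
`tsupport ζ ⊆ M × (−∞, b)`. Everything is proved; no definitions.

## References

* [Treves1975] F. Trèves, *Basic Linear Partial Differential Equations* (1975), §41, Lemma 41.2, (41.7),
  Thm. 40.1.
* J.-L. Lions, *Équations différentielles opérationnelles et problèmes aux limites* (1961).
-/

noncomputable section

set_option linter.dupNamespace false

open scoped Manifold ContDiff ENNReal NNReal Topology InnerProductSpace
open MeasureTheory Set Filter
open Literature.Geometry.Lorentzian Literature.Geometry.Riemannian

namespace Summit.SmoothPoincare4.SmoothPoincare4.Theorems.BakryEmeryComplete

open NoncompactShrinkerGapHeat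

section VeryWeak

variable {n : ℕ} {M : Type*} [TopologicalSpace M] [T2Space M] [SecondCountableTopology M]
  [ChartedSpace (EuclideanSpace ℝ (Fin n)) M] [IsManifold (𝓡 n) ∞ M] [T3Space M] [MeasurableSpace M]
  [BorelSpace M]
  {g : PseudoRiemannianMetric (𝓡 n) ∞ (EuclideanSpace ℝ (Fin n)) (TangentSpace (𝓡 n) : M → Type _)}

/-- **Lions' very weak `L²` existence for the static linear heat equation with zero initial data on a
complete manifold, from the energy inequality** (Trèves 1975, §41, proof of Thm. 40.1 via Lemma 41.2; the
shrinker toolkit's `exists_veryWeak_linearHeat_static` with its hypothesis `Q ≥ 1` replaced by the energy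
inequality `hcoer` it was used for). [cite: Treves1975, §41, Lemma 41.2 and Thm. 40.1] -/
theorem exists_veryWeak_linearHeat_of_energyIneq (hg : g.IsRiemannian) {Q G : ℝ → M → ℝ}
    (hQ : ContMDiff ((𝓡 n).prod 𝓘(ℝ, ℝ)) 𝓘(ℝ, ℝ) ∞ fun p : M × ℝ ↦ Q p.2 p.1)
    (hG : ContMDiff ((𝓡 n).prod 𝓘(ℝ, ℝ)) 𝓘(ℝ, ℝ) ∞ fun p : M × ℝ ↦ G p.2 p.1)
    (hGc : HasCompactSupport fun p : M × ℝ ↦ G p.2 p.1) {a b : ℝ}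
    (hcoer : ∀ (K : Set M) (φ : M × ℝ → ℝ), IsCompact K → ContMDiff ((𝓡 n).prod 𝓘(ℝ, ℝ)) 𝓘(ℝ, ℝ) ∞ φ →
      (∀ p : M × ℝ, p.1 ∉ K → φ p = 0) → (∀ (x : M) (s : ℝ), b ≤ s → φ (x, s) = 0) →
      ∫ p in univ ×ˢ Ioo a b, φ p ^ 2 ∂g.riemVolume.prod (volume : Measure ℝ) ≤
        ∫ p in univ ×ˢ Ioo a b, φ p * (-(deriv (fun s ↦ φ (p.1, s)) p.2) -
          g.laplaceBeltrami (fun x ↦ φ (x, p.2)) p.1 + Q p.2 p.1 * φ p)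
          ∂g.riemVolume.prod (volume : Measure ℝ)) :
    ∃ u : M × ℝ → ℝ, Measurable u ∧ MemLp u 2 (g.riemVolume.prod (volume : Measure ℝ)) ∧
      (∀ p : M × ℝ, p.2 ∉ Ioo a b → u p = 0) ∧
      ∀ ζ : M × ℝ → ℝ, ContMDiff ((𝓡 n).prod 𝓘(ℝ, ℝ)) 𝓘(ℝ, ℝ) ∞ ζ → HasCompactSupport ζ →
        tsupport ζ ⊆ univ ×ˢ Iio b →
        ∫ p, u p * (-(deriv (fun s ↦ ζ (p.1, s)) p.2) - g.laplaceBeltrami (fun x ↦ ζ (x, p.2)) p.1 +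
            Q p.2 p.1 * ζ p) ∂(g.riemVolume.prod (volume : Measure ℝ)) =
          ∫ p in univ ×ˢ Ioo a b, G p.2 p.1 * ζ p ∂(g.riemVolume.prod (volume : Measure ℝ)) := by
  classical
  haveI : LocallyCompactSpace M := ChartedSpace.locallyCompactSpace (EuclideanSpace ℝ (Fin n)) M
  set μ₀ : Measure M := g.riemVolume with hμ₀
  haveI : IsFiniteMeasureOnCompacts μ₀ := CarrilloNi2009_shrinkerLSI.isFiniteMeasureOnCompacts_riemVolume hg
  have hfam : IsContMDiffFamilyOn ∞ (fun _ : ℝ ↦ g) univ := isContMDiffFamilyOn_const g univ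
  set S : Set (M × ℝ) := univ ×ˢ Ioo a b with hS
  have hSm : MeasurableSet S := MeasurableSet.univ.prod measurableSet_Ioo
  set ν : Measure (M × ℝ) := (μ₀.prod (volume : Measure ℝ)).restrict S with hν
  -- the adjoint operator
  set A : (M × ℝ → ℝ) → (M × ℝ → ℝ) := fun φ p ↦
    -(deriv (fun s ↦ φ (p.1, s)) p.2) - g.laplaceBeltrami (fun x ↦ φ (x, p.2)) p.1 +
      Q p.2 p.1 * φ p with hA
  have hAs : ∀ {φ : M × ℝ → ℝ}, ContMDiff ((𝓡 n).prod 𝓘(ℝ, ℝ)) 𝓘(ℝ, ℝ) ∞ φ →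
      ContMDiff ((𝓡 n).prod 𝓘(ℝ, ℝ)) 𝓘(ℝ, ℝ) ∞ (A φ) := fun hφ ↦
    ((contMDiff_deriv_time hφ).neg.sub (contMDiff_laplaceBeltrami_family hfam hφ)).add (hQ.mul hφ)
  -- `A φ` vanishes off `K × ℝ` when `φ` does
  have hA0 : ∀ {φ : M × ℝ → ℝ} {K : Set M}, IsCompact K → (∀ p : M × ℝ, p.1 ∉ K → φ p = 0) →
      ∀ p : M × ℝ, p.1 ∉ K → A φ p = 0 := by
    intro φ K hK hφK p hp
    have ht : (fun s ↦ φ (p.1, s)) = fun _ ↦ (0 : ℝ) := funext fun s ↦ hφK (p.1, s) hp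
    have hev : (fun x ↦ φ (x, p.2)) =ᶠ[𝓝 p.1] fun _ ↦ (0 : ℝ) := by
      filter_upwards [hK.isClosed.isOpen_compl.mem_nhds hp] with x hx
      exact hφK (x, p.2) hx
    simp only [hA]
    rw [ht, deriv_const, laplaceBeltrami_eq_zero_of_eventuallyEq_zero _ hev, hφK p hp]
    ring
  -- continuous functions vanishing off some `K × ℝ` are in `L²(ν)`
  have hmemS : ∀ {F : M × ℝ → ℝ} {K : Set M}, IsCompact K → Continuous F →
      (∀ p : M × ℝ, p.1 ∉ K → F p = 0) → MemLp F 2 ν := by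
    intro F K hK hF hF0
    rw [memLp_two_iff_integrable_sq hF.aestronglyMeasurable]
    have h2 : ∀ p : M × ℝ, p.1 ∉ K → F p ^ 2 = 0 := fun p hp ↦ by rw [hF0 p hp]; ring
    exact integrableOn_strip_of_continuous_of_vanish hg hK (hF.fun_pow 2) h2 a b
  -- the test space: smooth, vanishing off `K × ℝ` for a compact `K`, and for `s ≥ b'`, some `b' < b`
  set Φ : Submodule ℝ (M × ℝ → ℝ) :=
    { carrier := {φ | ContMDiff ((𝓡 n).prod 𝓘(ℝ, ℝ)) 𝓘(ℝ, ℝ) ∞ φ ∧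
        (∃ K : Set M, IsCompact K ∧ ∀ p : M × ℝ, p.1 ∉ K → φ p = 0) ∧
        ∃ b' < b, ∀ p : M × ℝ, b' ≤ p.2 → φ p = 0}
      add_mem' := by
        rintro φ ψ ⟨hφ, ⟨K₁, hK₁, hK₁0⟩, b₁, hb₁, h₁⟩ ⟨hψ, ⟨K₂, hK₂, hK₂0⟩, b₂, hb₂, h₂⟩
        refine ⟨hφ.add hψ, ⟨K₁ ∪ K₂, hK₁.union hK₂, fun p hp ↦ ?_⟩, max b₁ b₂, max_lt hb₁ hb₂,
          fun p hp ↦ ?_⟩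
        · rw [mem_union, not_or] at hp
          simp only [Pi.add_apply, hK₁0 p hp.1, hK₂0 p hp.2, add_zero]
        · simp only [Pi.add_apply, h₁ p ((le_max_left _ _).trans hp), h₂ p ((le_max_right _ _).trans hp),
            add_zero]
      zero_mem' := ⟨contMDiff_const, ⟨∅, isCompact_empty, fun p _ ↦ rfl⟩, b - 1, by linarith,
        fun p _ ↦ rfl⟩
      smul_mem' := by
        rintro c φ ⟨hφ, ⟨K₁, hK₁, hK₁0⟩, b₁, hb₁, h₁⟩
        refine ⟨(contMDiff_const.mul hφ :), ⟨K₁, hK₁, fun p hp ↦ ?_⟩, b₁, hb₁, fun p hp ↦ ?_⟩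
        · change c * φ p = 0
          rw [hK₁0 p hp, mul_zero]
        · change c * φ p = 0
          rw [h₁ p hp, mul_zero] } with hΦ
  have hΦs : ∀ φ : Φ, ContMDiff ((𝓡 n).prod 𝓘(ℝ, ℝ)) 𝓘(ℝ, ℝ) ∞ (φ : M × ℝ → ℝ) := fun φ ↦ φ.2.1
  have hΦK : ∀ φ : Φ, ∃ K : Set M, IsCompact K ∧ ∀ p : M × ℝ, p.1 ∉ K → (φ : M × ℝ → ℝ) p = 0 :=
    fun φ ↦ φ.2.2.1
  have hΦb : ∀ φ : Φ, ∀ x : M, ∀ s, b ≤ s → (φ : M × ℝ → ℝ) (x, s) = 0 := by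
    intro φ x s hs
    obtain ⟨b', hb', h'⟩ := φ.2.2.2
    exact h' (x, s) (hb'.le.trans hs)
  -- the linear maps into `L²(ν)`
  have hmemφ : ∀ φ : Φ, MemLp (φ : M × ℝ → ℝ) 2 ν := fun φ ↦ by
    obtain ⟨K, hK, hK0⟩ := hΦK φ
    exact hmemS hK (hΦs φ).continuous hK0
  have hmemA : ∀ φ : Φ, MemLp (A φ) 2 ν := fun φ ↦ by
    obtain ⟨K, hK, hK0⟩ := hΦK φ
    exact hmemS hK (hAs (hΦs φ)).continuous (hA0 hK hK0)
  set j : Φ →ₗ[ℝ] Lp ℝ 2 ν :=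
    { toFun := fun φ ↦ (hmemφ φ).toLp (φ : M × ℝ → ℝ)
      map_add' := fun φ ψ ↦ MemLp.toLp_add (hmemφ φ) (hmemφ ψ)
      map_smul' := fun c φ ↦ MemLp.toLp_const_smul c (hmemφ φ) } with hj
  have hAadd : ∀ φ ψ : Φ, A ((φ + ψ : Φ) : M × ℝ → ℝ) = A φ + A ψ := by
    intro φ ψ; funext p
    exact heatAdjoint_static_add Q (hΦs φ) (hΦs ψ) p
  have hAsmul : ∀ (c : ℝ) (φ : Φ), A ((c • φ : Φ) : M × ℝ → ℝ) = c • A φ := by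
    intro c φ; funext p
    exact heatAdjoint_static_smul Q (hΦs φ) c p
  set K : Φ →ₗ[ℝ] Lp ℝ 2 ν :=
    { toFun := fun φ ↦ (hmemA φ).toLp (A φ)
      map_add' := fun φ ψ ↦ by
        have h1 : (hmemA (φ + ψ)).toLp (A ((φ + ψ : Φ) : M × ℝ → ℝ)) =
            ((hmemA φ).add (hmemA ψ)).toLp (A φ + A ψ) :=
          MemLp.toLp_congr _ _ (Eventually.of_forall fun p ↦ by rw [hAadd])
        rw [h1]; exact MemLp.toLp_add (hmemA φ) (hmemA ψ)
      map_smul' := fun c φ ↦ by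
        have h1 : (hmemA (c • φ)).toLp (A ((c • φ : Φ) : M × ℝ → ℝ)) =
            ((hmemA φ).const_smul c).toLp (c • A φ) :=
          MemLp.toLp_congr _ _ (Eventually.of_forall fun p ↦ by rw [hAsmul])
        rw [h1]; exact MemLp.toLp_const_smul c (hmemA φ) } with hK
  -- `G` vanishes off `KG × ℝ`, `KG` compact
  set KG : Set M := Prod.fst '' tsupport (fun p : M × ℝ ↦ G p.2 p.1) with hKG
  have hKGc : IsCompact KG := hGc.isCompact.image continuous_fst
  have hG0 : ∀ p : M × ℝ, p.1 ∉ KG → G p.2 p.1 = 0 := fun p hp ↦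
    image_eq_zero_of_notMem_tsupport (f := fun p : M × ℝ ↦ G p.2 p.1) fun h ↦ hp ⟨p, h, rfl⟩
  have hGmem : MemLp (fun p : M × ℝ ↦ G p.2 p.1) 2 ν := hmemS hKGc hG.continuous hG0
  set ℓ : Φ →ₗ[ℝ] ℝ :=
    { toFun := fun φ ↦ ∫ p, G p.2 p.1 * (φ : M × ℝ → ℝ) p ∂ν
      map_add' := fun φ ψ ↦ by
        have hi : ∀ θ : Φ, Integrable (fun p ↦ G p.2 p.1 * (θ : M × ℝ → ℝ) p) ν := fun θ ↦ by
          have h0 : ∀ p : M × ℝ, p.1 ∉ KG → G p.2 p.1 * (θ : M × ℝ → ℝ) p = 0 := fun p hp ↦ by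
            rw [hG0 p hp, zero_mul]
          exact integrableOn_strip_of_continuous_of_vanish hg hKGc
            (hG.continuous.fun_mul (hΦs θ).continuous) h0 a b
        rw [← integral_add (hi φ) (hi ψ)]
        exact integral_congr_ae (Eventually.of_forall fun p ↦ by
          simp only [Submodule.coe_add, Pi.add_apply]; ring)
      map_smul' := fun c φ ↦ by
        rw [RingHom.id_apply, smul_eq_mul, ← MeasureTheory.integral_const_mul]
        exact integral_congr_ae (Eventually.of_forall fun p ↦ by
          simp only [Submodule.coe_smul, Pi.smul_apply, smul_eq_mul]; ring) } with hℓ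
  -- the gauge and the constant
  set nΦ : Φ → ℝ := fun φ ↦ Real.sqrt (∫ p, (φ : M × ℝ → ℝ) p ^ 2 ∂ν) with hnΦ
  set C₁ : ℝ := Real.sqrt (∫ p, G p.2 p.1 ^ 2 ∂ν) with hC₁
  -- (i) coercivity
  have hcoerc : ∀ φ : Φ, 1 * nΦ φ ^ 2 ≤ ⟪K φ, j φ⟫_ℝ := by
    intro φ
    have hint_eq : ⟪K φ, j φ⟫_ℝ = ∫ p, A φ p * (φ : M × ℝ → ℝ) p ∂ν :=
      inner_toLp_toLp_eq_integral (hmemA φ) (hmemφ φ)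
    rw [one_mul, hint_eq, hnΦ]
    dsimp only
    rw [Real.sq_sqrt (integral_nonneg fun p ↦ sq_nonneg _)]
    obtain ⟨K', hK', hK'0⟩ := hΦK φ
    have hen := hcoer K' φ hK' (hΦs φ) hK'0 (hΦb φ)
    rw [hν]
    calc ∫ p in S, (φ : M × ℝ → ℝ) p ^ 2 ∂μ₀.prod (volume : Measure ℝ)
        ≤ _ := hen
      _ = ∫ p in S, A φ p * (φ : M × ℝ → ℝ) p ∂μ₀.prod (volume : Measure ℝ) :=
          integral_congr_ae (Eventually.of_forall fun p ↦ by simp only [hA]; ring)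
  -- (ii) the inclusion is bounded (constant `1`)
  have hemb : ∀ φ : Φ, ‖j φ‖ ≤ 1 * nΦ φ := by
    intro φ
    change ‖(hmemφ φ).toLp (φ : M × ℝ → ℝ)‖ ≤ 1 * nΦ φ
    rw [norm_toLp_two_eq_sqrt, one_mul]
  -- (iii) the functional is bounded (Cauchy–Schwarz)
  have hℓb : ∀ φ : Φ, |ℓ φ| ≤ C₁ * nΦ φ := by
    intro φ
    change |∫ p, G p.2 p.1 * (φ : M × ℝ → ℝ) p ∂ν| ≤ C₁ * nΦ φ
    have hcs := abs_real_inner_le_norm (hGmem.toLp _) ((hmemφ φ).toLp _)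
    rw [inner_toLp_toLp_eq_integral, norm_toLp_two_eq_sqrt, norm_toLp_two_eq_sqrt] at hcs
    exact hcs
  -- Lions' projection lemma
  obtain ⟨U, hU⟩ := Literature.Analysis.PDE.lions_projection K j ℓ nΦ one_pos zero_le_one (Real.sqrt_nonneg _)
    (fun φ ↦ Real.sqrt_nonneg _) hcoerc hemb hℓb
  -- a measurable representative, extended by zero off the strip
  set Ut : M × ℝ → ℝ := (Lp.memLp U).1.mk U with hUt
  have hUtm : Measurable Ut := (Lp.memLp U).1.stronglyMeasurable_mk.measurable
  have hUUt : (U : M × ℝ → ℝ) =ᵐ[ν] Ut := (Lp.memLp U).1.ae_eq_mk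
  have hUt2 : MemLp Ut 2 ν := (Lp.memLp U).ae_eq hUUt
  set u : M × ℝ → ℝ := S.indicator Ut with hu
  refine ⟨u, hUtm.indicator hSm, ?_, ?_, ?_⟩
  · rw [hu, memLp_indicator_iff_restrict hSm]; exact hUt2
  · intro p hp
    rw [hu, indicator_of_notMem (fun h' : p ∈ S ↦ hp h'.2)]
  · intro ζ hζ hζc hζT
    -- `ζ` belongs to the test space
    have hζΦ : ζ ∈ Φ := by
      refine ⟨hζ, ⟨Prod.fst '' tsupport ζ, hζc.isCompact.image continuous_fst, fun p hp ↦
        image_eq_zero_of_notMem_tsupport fun h ↦ hp ⟨p, h, rfl⟩⟩, ?_⟩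
      set Kt : Set ℝ := Prod.snd '' tsupport ζ with hKt
      have hKtc : IsCompact Kt := hζc.isCompact.image continuous_snd
      rcases Kt.eq_empty_or_nonempty with he | hne
      · refine ⟨b - 1, by linarith, fun p _ ↦ ?_⟩
        have : p ∉ tsupport ζ := fun h' ↦ by
          have : p.2 ∈ Kt := ⟨p, h', rfl⟩
          rw [he] at this; exact this
        exact image_eq_zero_of_notMem_tsupport this
      · obtain ⟨s₀, hs₀, hmax⟩ := hKtc.exists_isMaxOn hne continuous_id.continuousOn
        obtain ⟨p₀, hp₀, rfl⟩ := hs₀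
        have hs₀b : p₀.2 < b := (hζT hp₀).2
        refine ⟨(p₀.2 + b) / 2, by linarith, fun p hp ↦ ?_⟩
        have : p ∉ tsupport ζ := fun h' ↦ by
          have hle : p.2 ≤ p₀.2 := hmax ⟨p, h', rfl⟩
          linarith
        exact image_eq_zero_of_notMem_tsupport this
    have key := hU ⟨ζ, hζΦ⟩
    -- unfold both sides
    have hKζ : ⟪U, K ⟨ζ, hζΦ⟩⟫_ℝ = ∫ p, Ut p * A ζ p ∂ν := by
      have h1 : ⟪U, K ⟨ζ, hζΦ⟩⟫_ℝ = ⟪hUt2.toLp Ut, (hmemA ⟨ζ, hζΦ⟩).toLp (A ζ)⟫_ℝ := by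
        congr 1
        exact (Lp.toLp_coeFn U (Lp.memLp U)).symm.trans (MemLp.toLp_congr _ _ hUUt)
      rw [h1, inner_toLp_toLp_eq_integral]
    rw [hKζ] at key
    change ∫ p, Ut p * A ζ p ∂ν = ∫ p, G p.2 p.1 * ζ p ∂ν at key
    rw [hν] at key
    have hlhs : ∫ p, u p * A ζ p ∂μ₀.prod (volume : Measure ℝ) =
        ∫ p in S, Ut p * A ζ p ∂μ₀.prod (volume : Measure ℝ) := by
      rw [← MeasureTheory.integral_indicator hSm]
      refine integral_congr_ae (Eventually.of_forall fun p ↦ ?_)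
      simp only [hu]
      by_cases hp : p ∈ S
      · rw [indicator_of_mem hp, indicator_of_mem hp]
      · rw [indicator_of_notMem hp, indicator_of_notMem hp, zero_mul]
    rw [hlhs]
    exact key


end VeryWeak

end Summit.SmoothPoincare4.SmoothPoincare4.Theorems.BakryEmeryComplete

end
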